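import Summits.Schanuel.Schanuel.Theorems.ZilberEacDiagonalCriticalElimination
import HarnessLib

/-!
# THEOREM N₂^(δ) — elimination along (bounded, linear, degree-δ) growth

Zilber's Exponential-Algebraic Closedness, case ladder (host summit Schanuel, cell `pub-schanuel`,
seat 2, gen 14).  THEOREM N₂ (`ZilberEacDiagonalCriticalElimination`, gen 13) eliminates along
`(v, w, t) ~ (v*, W*D, T*D)`.  For targets of DEGREE `δ ≥ 2` at the critical size the diagonal-ray
solutions `x(m) = (2πiepm + δ log m)(1,1) + ρ(m)` have `x₀ ~ 2πiep·m` but `y₀ = e^{x₀} ~ e^{ρ₀*}m^δ`: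
the third coordinate grows like the `δ`-th POWER of the second.  The same argument works with the
weight `m₁ + δm₂` on monomials `V^{m₀}W^{m₁}T^{m₂}`: dividing a relation by `D^{μ}` (`μ` = top
weight) the top class tends to `Q(v*, T*) = Σ_{m₁+δm₂=μ} g_m W*^{m₁}(v*)^{m₀}(T*)^{m₂}`, a NONZERO
polynomial of `ℂ[V, T]` (on the top class `m₂` determines `m₁`), vanishing on the generic family of
pairs — impossible.

**THEOREM N₂^(δ) (`mvPolynomial_eq_zero_of_bddLinPow`)** and its density form
**`unprojectedDense_of_bddLinPow`** (coordinates `c₀, c₁, c₂` with `p(c₁) - p(c₀) → v*`,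
`p(c₀)/D → W* ≠ 0`, `p(c₂)/D^δ → T*`).  For `δ = 1` this is THEOREM N₂.

HONEST FRAMING: an elimination lemma; `EC(3,2)` OPEN; NOT Schanuel's conjecture; EAC ⇏ SC.
-/

noncomputable section

open Complex MvPolynomial Filter Topology
open Literature.NumberTheory.Transcendental Literature.ModelTheory.Zilber
  Literature.ModelTheory.ExponentialFields

set_option linter.dupNamespace false

namespace Summit.Schanuel.Schanuel.Theorems

/-! ## Part A. THEOREM N₂^(δ) -/

section Engine

/-- **THEOREM N₂^(δ) (elimination along `(bdd, lin, pow-δ)` growth with a generic family of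
pairs).**  See the module docstring. (new) -/
theorem mvPolynomial_eq_zero_of_bddLinPow (G : MvPolynomial (Fin 3) ℂ) (δ : ℕ) {Wst : ℂ}
    (hW : Wst ≠ 0) {PS : Set (ℂ × ℂ)}
    (hPS : ∀ Q : MvPolynomial (Fin 2) ℂ, Q ≠ 0 → ∃ vt ∈ PS, eval ![vt.1, vt.2] Q ≠ 0)
    (h : ∀ vt ∈ PS, ∃ (x : ℕ → Fin 3 → ℂ) (D : ℕ → ℝ),
      Tendsto D atTop atTop ∧
      Tendsto (fun k => x k 0) atTop (𝓝 vt.1) ∧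
      Tendsto (fun k => x k 1 / D k) atTop (𝓝 Wst) ∧
      Tendsto (fun k => x k 2 / (D k) ^ δ) atTop (𝓝 vt.2) ∧
      ∀ᶠ k in atTop, eval (x k) G = 0) :
    G = 0 := by
  classical
  by_contra hG0
  have hne : G.support.Nonempty := MvPolynomial.support_nonempty.2 hG0
  -- the top weight `m 1 + δ m 2`
  obtain ⟨m₁, hm₁, hmax₁⟩ := G.support.exists_max_image (fun m : Fin 3 →₀ ℕ => m 1 + δ * m 2) hne
  set Dm : ℕ := m₁ 1 + δ * m₁ 2 with hDm
  set S₁ : Finset (Fin 3 →₀ ℕ) := G.support.filter fun m => m 1 + δ * m 2 = Dm with hS₁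
  have hm₁S₁ : m₁ ∈ S₁ := Finset.mem_filter.2 ⟨hm₁, rfl⟩
  have hS₁sub : ∀ m ∈ S₁, m ∈ G.support ∧ m 1 + δ * m 2 = Dm := fun m hm => Finset.mem_filter.1 hm
  -- the two-variable polynomial `Q(V, T) = Σ_{top class} g_m W*^{m 1} V^{m 0} T^{m 2}`
  set Q : MvPolynomial (Fin 2) ℂ := ∑ m ∈ S₁,
    monomial (Finsupp.single 0 (m 0) + Finsupp.single 1 (m 2)) (coeff m G * Wst ^ m 1) with hQ
  have hQ0 : Q ≠ 0 := by
    intro hQ0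
    have hc : coeff (Finsupp.single 0 (m₁ 0) + Finsupp.single 1 (m₁ 2)) Q =
        coeff m₁ G * Wst ^ m₁ 1 := by
      rw [hQ, coeff_sum, Finset.sum_eq_single m₁]
      · rw [coeff_monomial, if_pos rfl]
      · intro m hm hne'
        rw [coeff_monomial, if_neg]
        intro heq
        apply hne'
        have h0 : m 0 = m₁ 0 := by
          have := congrArg (fun f => f 0) heq
          simpa using this
        have h2 : m 2 = m₁ 2 := by
          have := congrArg (fun f => f 1) heq
          simpa using this
        obtain ⟨-, h12⟩ := hS₁sub m hm
        have h1 : m 1 = m₁ 1 := by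
          rw [h2, hDm] at h12
          omega
        ext i
        fin_cases i
        · exact h0
        · exact h1
        · exact h2
      · intro h'; exact absurd hm₁S₁ h'
    rw [hQ0, coeff_zero] at hc
    exact mul_ne_zero (mem_support_iff.1 hm₁) (pow_ne_zero _ hW) hc.symm
  -- every pair of `PS` is a zero of `Q`
  have hroot : ∀ vt ∈ PS, eval ![vt.1, vt.2] Q = 0 := by
    intro vt hvt
    obtain ⟨x, D, hD, hv, hw, ht, hzero⟩ := h vt hvt
    have hD0 : ∀ᶠ k in atTop, D k ≠ 0 := (hD.eventually_gt_atTop 0).mono fun k hk => hk.ne'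
    -- normalising factors
    set scal : (Fin 3 →₀ ℕ) → ℕ → ℝ := fun m k => D k ^ (m 1 + δ * m 2) / D k ^ Dm with hscal
    set slim : (Fin 3 →₀ ℕ) → ℝ := fun m => if m ∈ S₁ then 1 else 0 with hslim
    have hscal_lim : ∀ m ∈ G.support, Tendsto (scal m) atTop (𝓝 (slim m)) := by
      intro m hm
      by_cases hmS₁ : m ∈ S₁
      · obtain ⟨-, h12⟩ := hS₁sub m hmS₁
        have e1 : slim m = 1 := by simp only [hslim, if_pos hmS₁]
        rw [e1]
        refine tendsto_const_nhds.congr' ?_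
        filter_upwards [hD0] with k hDk
        simp only [hscal]
        rw [h12, div_self (pow_ne_zero _ hDk)]
      · have e0 : slim m = 0 := by simp only [hslim, if_neg hmS₁]
        rw [e0]
        have hle : m 1 + δ * m 2 ≤ Dm := hmax₁ m hm
        have hlt : m 1 + δ * m 2 < Dm := lt_of_le_of_ne hle fun heq =>
          hmS₁ (Finset.mem_filter.2 ⟨hm, heq⟩)
        have hinv : Tendsto (fun k => (D k ^ (Dm - (m 1 + δ * m 2)))⁻¹) atTop (𝓝 0) :=
          (tendsto_pow_atTop (by omega)).inv_tendsto_atTop.comp hD |>.congr fun _ => rfl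
        refine hinv.congr' ?_
        filter_upwards [hD0] with k hDk
        simp only [hscal]
        rw [eq_div_iff (pow_ne_zero _ hDk), ← pow_sub_mul_pow (D k) hle,
          inv_mul_cancel_left₀ (pow_ne_zero _ hDk)]
    -- the normalised terms
    set term : (Fin 3 →₀ ℕ) → ℕ → ℂ := fun m k =>
      coeff m G * ((x k 0) ^ m 0 * (x k 1 / D k) ^ m 1 * (x k 2 / (D k) ^ δ) ^ m 2) * (scal m k : ℂ)
      with hterm
    have hterm_lim : ∀ m ∈ G.support, Tendsto (term m) atTop
        (𝓝 (coeff m G * (vt.1 ^ m 0 * Wst ^ m 1 * vt.2 ^ m 2) * (slim m : ℂ))) := by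
      intro m hm
      exact (tendsto_const_nhds.mul (((hv.pow _).mul (hw.pow _)).mul (ht.pow _))).mul
        ((continuous_ofReal.tendsto _).comp (hscal_lim m hm))
    have hsum_lim : Tendsto (fun k => ∑ m ∈ G.support, term m k) atTop
        (𝓝 (∑ m ∈ G.support, coeff m G * (vt.1 ^ m 0 * Wst ^ m 1 * vt.2 ^ m 2) * (slim m : ℂ))) :=
      tendsto_finsetSum _ fun m hm => hterm_lim m hm
    have hsum_eq : ∀ᶠ k in atTop, ∑ m ∈ G.support, term m k = eval (x k) G / (D k : ℂ) ^ Dm := by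
      filter_upwards [hD0] with k hDk
      rw [eval_eq_sum_fin_three, Finset.sum_div]
      refine Finset.sum_congr rfl fun m _ => ?_
      have hDc : (D k : ℂ) ≠ 0 := ofReal_ne_zero.2 hDk
      simp only [hterm, hscal, div_pow]
      push_cast
      rw [← pow_mul, pow_add, pow_mul]
      field_simp
    have hlim0 : Tendsto (fun k => ∑ m ∈ G.support, term m k) atTop (𝓝 0) := by
      refine tendsto_const_nhds.congr' ?_
      filter_upwards [hsum_eq, hzero] with k hk hz
      rw [hk, hz, zero_div]
    have hval : ∑ m ∈ G.support, coeff m G * (vt.1 ^ m 0 * Wst ^ m 1 * vt.2 ^ m 2) * (slim m : ℂ) =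
        eval ![vt.1, vt.2] Q := by
      have e1 : ∀ m ∈ G.support, coeff m G * (vt.1 ^ m 0 * Wst ^ m 1 * vt.2 ^ m 2) * (slim m : ℂ) =
          if m ∈ S₁ then coeff m G * Wst ^ m 1 * (vt.1 ^ m 0 * vt.2 ^ m 2) else 0 := by
        intro m _
        simp only [hslim]
        split_ifs
        · push_cast; ring
        · push_cast; ring
      rw [Finset.sum_congr rfl e1, Finset.sum_ite_mem,
        Finset.inter_eq_right.2 (fun m hm => (hS₁sub m hm).1), hQ, map_sum]
      refine Finset.sum_congr rfl fun m _ => ?_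
      rw [eval_monomial]
      congr 1
      rw [Finsupp.prod_add_index' (fun _ => pow_zero _) (fun _ _ _ => pow_add _ _ _)]
      simp [Finsupp.prod_single_index]
    have huniq := tendsto_nhds_unique hsum_lim hlim0
    rw [hval] at huniq
    exact huniq
  obtain ⟨vt, hvt, hne'⟩ := hPS Q hQ0
  exact hne' (hroot vt hvt)

end Engine

/-! ## Part B. Density form -/

section Density

variable {n : ℕ}

/-- **Density form of THEOREM N₂^(δ).**  `S ⊆ ℂⁿ × ℂⁿ` irreducible closed with `dim S ≤ 3`, three
coordinates `c₀, c₁, c₂`, `W* ≠ 0`, `δ ∈ ℕ`, and `𝒮 ⊆ ℂ × ℂ` on which no nonzero `Q ∈ ℂ[V, T]`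
vanishes identically; if for every `(v*, T*) ∈ 𝒮` there are exponential points `p_k ∈ S ∩ Γ_exp`
(all large `k`) and `D_k → ∞` with `p_k(c₁) - p_k(c₀) → v*`, `p_k(c₀)/D_k → W*`,
`p_k(c₂)/D_k^δ → T*`, then `I(S ∩ Γ_exp) = I(S)`. (new) -/
theorem unprojectedDense_of_bddLinPow {S : Set (Fin n ⊕ Fin n → ℂ)}
    (hS : IsIrreducibleClosed ℂ S) (hdim : zariskiDim ℂ S ≤ ((2 + 1 : ℕ) : WithBot ℕ∞))
    (c : Fin 3 → Fin n ⊕ Fin n) (δ : ℕ) {Wst : ℂ} (hW : Wst ≠ 0) {PS : Set (ℂ × ℂ)}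
    (hPS : ∀ Q : MvPolynomial (Fin 2) ℂ, Q ≠ 0 → ∃ vt ∈ PS, eval ![vt.1, vt.2] Q ≠ 0)
    (h : ∀ vt ∈ PS, ∃ (p : ℕ → Fin n ⊕ Fin n → ℂ) (D : ℕ → ℝ),
      (∀ᶠ k in atTop, p k ∈ S ∩ expGraph ℂ n) ∧ Tendsto D atTop atTop ∧
      Tendsto (fun k => p k (c 1) - p k (c 0)) atTop (𝓝 vt.1) ∧
      Tendsto (fun k => p k (c 0) / D k) atTop (𝓝 Wst) ∧
      Tendsto (fun k => p k (c 2) / (D k) ^ δ) atTop (𝓝 vt.2)) :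
    UnprojectedDense S := by
  refine unprojectedDense_of_no_relation hS hdim c fun H hH => ?_
  by_contra hno
  push Not at hno
  apply bind₁_shear_ne_zero hH
  refine mvPolynomial_eq_zero_of_bddLinPow _ δ hW hPS fun vt hvt => ?_
  obtain ⟨p, D, hp, hD, hv, hw, ht⟩ := h vt hvt
  refine ⟨fun k => ![p k (c 1) - p k (c 0), p k (c 0), p k (c 2)], D, hD, ?_, ?_, ?_, ?_⟩
  · simpa using hv
  · simpa using hw
  · simpa using ht
  · filter_upwards [hp] with k hk
    rw [eval_bind₁_shear, add_sub_cancel]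
    have e : (![p k (c 0), p k (c 1), p k (c 2)] : Fin 3 → ℂ) = fun i => p k (c i) := by
      funext i; fin_cases i <;> simp
    rw [e]
    exact hno _ hk

end Density

end Summit.Schanuel.Schanuel.Theorems

end
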